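import Literature.NumberTheory.GaloisCohomology.KolyvaginSystems
import HarnessLib

/-!
# Restricting Kolyvagin systems to a SUB-class of Kolyvagin primes: `KS₁(T, 𝓕, 𝒫) → KS₁(T, 𝓕, 𝒫′)`,
# `𝒫′ ⊆ 𝒫`, and the transfer of "free of rank one + evaluation bijective" from `𝒫` to `𝒫′` given
# rigidity on `𝒫′` at one common core vertex (route `KimAtThreeKolyvagin`, rung W2; cell `bsd-addord`,
# seat `bsd-addord-w2-c2` gen 5 — the algebra of the S24-DEEP discharge)

HONEST FRAMING. TOOL theorems, pure algebra over the tree's Kolyvagin-system vocabulary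
(`Literature.NumberTheory.GaloisCohomology.KolyvaginSystems`); no definition (the restriction is written
as the explicit function `n ↦ if n ⊆ 𝒫′ then κ n else 0`), no named fact, no `sorry`; nothing booked;
BSD is not proved by any of this. PURPOSE: the flagged port S24-DEEP (1)
(`GaloisImage.S24Deep.kolyvaginSystems_freeRankOne_zmod_three_pow_deep`) asserts [S24] Thm. 4.4 (1) for
a datum whose primes are a SUB-class `𝒫′` of Sakamoto's pinned class `𝒫`; Mazur–Rubin note such
sub-classes are harmless (Mem. AMS 799, §3.5 (H.5) «`𝒫_t ⊂ 𝒫 ⊂ 𝒫_1`», Cor. 4.5.2 (iv)). The formal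
content of "harmless" is this file: if two data `D̂` (primes `𝒫`) and `D` (primes `𝒫′ ⊆ 𝒫`) share
the transverse conditions and the comparison maps on `𝒫′`, then
* `isKolyvaginSystem_restrict` — restriction to the `𝒫′`-levels maps `KS₁(D̂, 𝓕) → KS₁(D, 𝓕)`;
* `restrict_bijective_of_bijective_of_rigid` — if at ONE common level `n₀` evaluation is BIJECTIVE
  on `KS₁(D̂, 𝓕)` (the pinned structure theorem at a core vertex) and INJECTIVE on `KS₁(D, 𝓕)`
  (rigidity on the sub-class — for `E[3^{k+1}]` this seat's port-free `…S24DeepRigidity`), the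
  restriction is a BIJECTION;
* `isFreeRankOneZMod_of_restrict`, `bijective_eval_of_restrict` — hence `KS₁(D, 𝓕)` is free of rank
  one over `ℤ/N` when `KS₁(D̂, 𝓕)` is, and evaluation at any `𝒫′`-level `d` is bijective on `KS₁(D, 𝓕)`
  when it is on `KS₁(D̂, 𝓕)` — i.e. conclusion (1) of [S24] Thm. 4.4 DESCENDS from `𝒫` to `𝒫′`.

References: B. Mazur, K. Rubin, Mem. AMS **799** (2004) §3.5 (H.5) (p. 27), Cor. 4.5.2 (iv) (p. 48),
Thm. 4.4.1 [MazurRubin2004]; R. Sakamoto, JTNB **36** (2024) Def. 4.1, Thm. 4.4 (1) (p. 926) [Sakamoto2024];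
K. Rubin, PCMI 18 (2011) Def. 2.2.1, Cor. 2.8.9 [Rubin2011].
-/

set_option autoImplicit false
-- the Theorems namespace of a single-conjunct summit repeats the summit name by design (D-0017)
set_option linter.dupNamespace false

noncomputable section

open scoped Classical NumberField
open Function NumberField IsDedekindDomain
open Literature.NumberTheory.GaloisRepresentations Literature.NumberTheory.GaloisRepresentations.DiscreteGaloisModule
  Literature.NumberTheory.GaloisCohomology

universe u

namespace Summit.BirchSwinnertonDyer.BirchSwinnertonDyer.Theorems.KimAtThreeDeepLowerS24DeepRestriction

variable {K : Type u} [Field K] [NumberField K] {M : Type u} [AddCommGroup M] [TopologicalSpace M]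
  [DiscreteTopology M] {ρ : DiscreteGaloisModule K M}
  {D D' : KolyvaginDatum ρ} {𝓕 : SelmerStructure ρ}

/-! ### §1 Restriction to a sub-class of primes -/

/-- A level of the sub-datum is a level of the big datum. [folklore] -/
theorem isLevel_of_isLevel_of_subset (hsub : D.primes ⊆ D'.primes) {d : Finset (HeightOneSpectrum (𝓞 K))}
    (hd : D.IsLevel d) : D'.IsLevel d :=
  fun _ hq => hsub (hd hq)

/-- Same transverse conditions ⟹ same level structures `𝓕(d)`. [cite: Sakamoto2024, Def. 3.3 (p. 922)] -/
theorem atLevel_eq_of_transverse_eq (htr : D.transverse = D'.transverse)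
    (d : Finset (HeightOneSpectrum (𝓞 K))) : D.atLevel 𝓕 d = D'.atLevel 𝓕 d := by
  change 𝓕.transverseAt D.transverse d = 𝓕.transverseAt D'.transverse d
  rw [htr]

/-- **Restriction of a Kolyvagin system to the levels of a sub-class is a Kolyvagin system** for the
sub-datum `D` (primes `𝒫′ ⊆ 𝒫 = D′.primes`, same transverse conditions, same comparison maps on `𝒫′`):
`n ↦ κ n` on the `𝒫′`-levels, `0` elsewhere. [cite: MazurRubin2004, §3.5 (H.5) (p. 27) and Cor. 4.5.2 (iv)]
[cite: Sakamoto2024, Def. 4.1 (p. 926)] -/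
theorem isKolyvaginSystem_restrict (hsub : D.primes ⊆ D'.primes) (htr : D.transverse = D'.transverse)
    (hfs : ∀ q ∈ D.primes, D.fs q = D'.fs q)
    {κ : Finset (HeightOneSpectrum (𝓞 K)) → galoisCohomology ρ 1} (hκ : D'.IsKolyvaginSystem 𝓕 κ) :
    D.IsKolyvaginSystem 𝓕 (fun n => if D.IsLevel n then κ n else 0) := by
  refine ⟨fun d hd => by simp only [if_neg hd], fun d hd => ?_, fun d hd q hq hqd => ?_⟩
  · simp only [if_pos hd]
    rw [atLevel_eq_of_transverse_eq htr]
    exact hκ.mem_selmerGroup d (isLevel_of_isLevel_of_subset hsub hd)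
  · have hdq : D.IsLevel (insert q d) := hd.insert hq
    simp only [if_pos hd, if_pos hdq]
    have h := hκ.fs_rel d (isLevel_of_isLevel_of_subset hsub hd) q (hsub hq) hqd
    rw [h]
    change (D'.fs q).comp _ (κ d) = (D.fs q).comp _ (κ d)
    rw [hfs q hq]

/-- The restriction, as a map `KS₁(D′, 𝓕) → KS₁(D, 𝓕)`, is additive. [folklore] -/
theorem restrict_add (hsub : D.primes ⊆ D'.primes) (htr : D.transverse = D'.transverse)
    (hfs : ∀ q ∈ D.primes, D.fs q = D'.fs q) (κ κ' : D'.kolyvaginSystems 𝓕) :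
    (⟨fun n => if D.IsLevel n then (κ + κ').1 n else 0,
        isKolyvaginSystem_restrict hsub htr hfs ((KolyvaginDatum.mem_kolyvaginSystems_iff _ _ _).mp
          (κ + κ').2)⟩ : D.kolyvaginSystems 𝓕) =
      (⟨fun n => if D.IsLevel n then κ.1 n else 0,
        isKolyvaginSystem_restrict hsub htr hfs ((KolyvaginDatum.mem_kolyvaginSystems_iff _ _ _).mp κ.2)⟩ :
          D.kolyvaginSystems 𝓕) +
      ⟨fun n => if D.IsLevel n then κ'.1 n else 0,
        isKolyvaginSystem_restrict hsub htr hfs ((KolyvaginDatum.mem_kolyvaginSystems_iff _ _ _).mp κ'.2)⟩ := by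
  apply Subtype.ext
  funext n
  change (if D.IsLevel n then (κ.1 + κ'.1) n else 0) =
    (if D.IsLevel n then κ.1 n else 0) + (if D.IsLevel n then κ'.1 n else 0)
  by_cases hn : D.IsLevel n
  · simp only [if_pos hn, Pi.add_apply]
  · simp only [if_neg hn, add_zero]

/-! ### §2 Bijectivity of the restriction from one common core vertex -/

/-- **The restriction `KS₁(D′, 𝓕) → KS₁(D, 𝓕)` is a BIJECTION** as soon as, at ONE level `n₀` of the
sub-datum, evaluation `κ ↦ κ_{n₀}` is BIJECTIVE on `KS₁(D′, 𝓕)` (the structure theorem for the big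
class at a core vertex) and INJECTIVE on `KS₁(D, 𝓕)` (rigidity on the sub-class). Injectivity: a
restriction vanishing on the sub-levels vanishes at `n₀`; surjectivity: lift `κ_{n₀}` to `KS₁(D′, 𝓕)` and
compare at `n₀`. [cite: MazurRubin2004, Thm. 4.4.1 and Cor. 4.5.2 (iv)] [cite: Rubin2011, Cor. 2.8.9 (2) (p. 25)] -/
theorem restrict_bijective_of_bijective_of_rigid (hsub : D.primes ⊆ D'.primes)
    (htr : D.transverse = D'.transverse) (hfs : ∀ q ∈ D.primes, D.fs q = D'.fs q)
    {n₀ : Finset (HeightOneSpectrum (𝓞 K))} (hn₀ : D.IsLevel n₀)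
    (hbij : Function.Bijective fun κ : D'.kolyvaginSystems 𝓕 =>
      (⟨κ.1 n₀, ((KolyvaginDatum.mem_kolyvaginSystems_iff D' 𝓕 κ.1).mp κ.2).mem_selmerGroup n₀
        (isLevel_of_isLevel_of_subset hsub hn₀)⟩ : (D'.atLevel 𝓕 n₀).selmerGroup))
    (hrig : ∀ κ : Finset (HeightOneSpectrum (𝓞 K)) → galoisCohomology ρ 1,
      D.IsKolyvaginSystem 𝓕 κ → κ n₀ = 0 → ∀ n, κ n = 0) :
    Function.Bijective fun κ : D'.kolyvaginSystems 𝓕 =>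
      (⟨fun n => if D.IsLevel n then κ.1 n else 0,
        isKolyvaginSystem_restrict hsub htr hfs ((KolyvaginDatum.mem_kolyvaginSystems_iff _ _ _).mp κ.2)⟩ :
          D.kolyvaginSystems 𝓕) := by
  constructor
  · -- injective: equal restrictions agree at `n₀`, a `D`-level
    intro κ κ' h
    have h0 : κ.1 n₀ = κ'.1 n₀ := by
      have := congrArg (fun x : D.kolyvaginSystems 𝓕 => x.1 n₀) h
      simpa only [if_pos hn₀] using this
    exact hbij.1 (Subtype.ext h0)
  · -- surjective: lift the value at `n₀`
    intro κ
    have hκ : D.IsKolyvaginSystem 𝓕 κ.1 := (KolyvaginDatum.mem_kolyvaginSystems_iff _ _ _).mp κ.2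
    have hmem : κ.1 n₀ ∈ (D'.atLevel 𝓕 n₀).selmerGroup := by
      rw [← atLevel_eq_of_transverse_eq htr]
      exact hκ.mem_selmerGroup n₀ hn₀
    obtain ⟨κ', hκ'⟩ := hbij.2 ⟨κ.1 n₀, hmem⟩
    refine ⟨κ', ?_⟩
    have hval : κ'.1 n₀ = κ.1 n₀ := congrArg Subtype.val hκ'
    -- the difference `restrict κ′ − κ` is a Kolyvagin system for `D` vanishing at `n₀`
    have hres : D.IsKolyvaginSystem 𝓕 (fun n => if D.IsLevel n then κ'.1 n else 0) :=
      isKolyvaginSystem_restrict hsub htr hfs ((KolyvaginDatum.mem_kolyvaginSystems_iff _ _ _).mp κ'.2)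
    have hdiff_mem : (fun n => if D.IsLevel n then κ'.1 n else 0) - κ.1 ∈ D.kolyvaginSystems 𝓕 :=
      sub_mem ((KolyvaginDatum.mem_kolyvaginSystems_iff _ _ _).mpr hres) κ.2
    have hdiff0 : ((fun n => if D.IsLevel n then κ'.1 n else 0) - κ.1) n₀ = 0 := by
      change (if D.IsLevel n₀ then κ'.1 n₀ else 0) - κ.1 n₀ = 0
      rw [if_pos hn₀, hval, sub_self]
    have hall := hrig _ ((KolyvaginDatum.mem_kolyvaginSystems_iff _ _ _).mp hdiff_mem) hdiff0
    apply Subtype.ext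
    funext n
    have h := hall n
    change (if D.IsLevel n then κ'.1 n else 0) - κ.1 n = 0 at h
    exact sub_eq_zero.mp h

/-! ### §3 Descent of "free of rank one" and of evaluation-bijectivity -/

/-- **`KS₁(D, 𝓕)` is free of rank one over `ℤ/N` if `KS₁(D′, 𝓕)` is**, under the hypotheses of
`restrict_bijective_of_bijective_of_rigid` (the restriction is then an additive bijection).
[cite: Sakamoto2024, Thm. 4.4 (1) (p. 926)] [cite: MazurRubin2004, §3.5 (H.5) and Cor. 4.5.2 (iv)] -/
theorem isFreeRankOneZMod_of_restrict (hsub : D.primes ⊆ D'.primes)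
    (htr : D.transverse = D'.transverse) (hfs : ∀ q ∈ D.primes, D.fs q = D'.fs q)
    {n₀ : Finset (HeightOneSpectrum (𝓞 K))} (hn₀ : D.IsLevel n₀)
    (hbij : Function.Bijective fun κ : D'.kolyvaginSystems 𝓕 =>
      (⟨κ.1 n₀, ((KolyvaginDatum.mem_kolyvaginSystems_iff D' 𝓕 κ.1).mp κ.2).mem_selmerGroup n₀
        (isLevel_of_isLevel_of_subset hsub hn₀)⟩ : (D'.atLevel 𝓕 n₀).selmerGroup))
    (hrig : ∀ κ : Finset (HeightOneSpectrum (𝓞 K)) → galoisCohomology ρ 1,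
      D.IsKolyvaginSystem 𝓕 κ → κ n₀ = 0 → ∀ n, κ n = 0)
    {N : ℕ} (hfree : KolyvaginSystem.IsFreeRankOneZMod (D'.kolyvaginSystems 𝓕) N) :
    KolyvaginSystem.IsFreeRankOneZMod (D.kolyvaginSystems 𝓕) N := by
  obtain ⟨e⟩ := hfree
  have hb := restrict_bijective_of_bijective_of_rigid hsub htr hfs hn₀ hbij hrig
  let r : D'.kolyvaginSystems 𝓕 →+ D.kolyvaginSystems 𝓕 :=
    { toFun := fun κ => ⟨fun n => if D.IsLevel n then κ.1 n else 0,
        isKolyvaginSystem_restrict hsub htr hfs ((KolyvaginDatum.mem_kolyvaginSystems_iff _ _ _).mp κ.2)⟩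
      map_zero' := by
        apply Subtype.ext
        funext n
        change (if D.IsLevel n then (0 : D'.kolyvaginSystems 𝓕).1 n else 0) = 0
        split_ifs <;> rfl
      map_add' := fun κ κ' => restrict_add hsub htr hfs κ κ' }
  have hrb : Function.Bijective r := hb
  exact ⟨(AddEquiv.ofBijective r hrb).symm.trans e⟩

/-- **Evaluation at a sub-level `d` is bijective on `KS₁(D, 𝓕)` if it is on `KS₁(D′, 𝓕)`**, under the
hypotheses of `restrict_bijective_of_bijective_of_rigid` (evaluation commutes with restriction at the
levels of `D`). [cite: Sakamoto2024, Thm. 4.4 (1) (p. 926)] [cite: Rubin2011, Cor. 2.8.9 (2) (p. 25)] -/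
theorem bijective_eval_of_restrict (hsub : D.primes ⊆ D'.primes)
    (htr : D.transverse = D'.transverse) (hfs : ∀ q ∈ D.primes, D.fs q = D'.fs q)
    {n₀ : Finset (HeightOneSpectrum (𝓞 K))} (hn₀ : D.IsLevel n₀)
    (hbij : Function.Bijective fun κ : D'.kolyvaginSystems 𝓕 =>
      (⟨κ.1 n₀, ((KolyvaginDatum.mem_kolyvaginSystems_iff D' 𝓕 κ.1).mp κ.2).mem_selmerGroup n₀
        (isLevel_of_isLevel_of_subset hsub hn₀)⟩ : (D'.atLevel 𝓕 n₀).selmerGroup))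
    (hrig : ∀ κ : Finset (HeightOneSpectrum (𝓞 K)) → galoisCohomology ρ 1,
      D.IsKolyvaginSystem 𝓕 κ → κ n₀ = 0 → ∀ n, κ n = 0)
    {d : Finset (HeightOneSpectrum (𝓞 K))} (hd : D.IsLevel d)
    (hbijd : Function.Bijective fun κ : D'.kolyvaginSystems 𝓕 =>
      (⟨κ.1 d, ((KolyvaginDatum.mem_kolyvaginSystems_iff D' 𝓕 κ.1).mp κ.2).mem_selmerGroup d
        (isLevel_of_isLevel_of_subset hsub hd)⟩ : (D'.atLevel 𝓕 d).selmerGroup)) :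
    Function.Bijective fun κ : D.kolyvaginSystems 𝓕 =>
      (⟨κ.1 d, ((KolyvaginDatum.mem_kolyvaginSystems_iff D 𝓕 κ.1).mp κ.2).mem_selmerGroup d hd⟩ :
        (D.atLevel 𝓕 d).selmerGroup) := by
  have hb := restrict_bijective_of_bijective_of_rigid hsub htr hfs hn₀ hbij hrig
  have heq : D.atLevel 𝓕 d = D'.atLevel 𝓕 d := atLevel_eq_of_transverse_eq htr d
  constructor
  · intro κ κ' h
    obtain ⟨μ₁, rfl⟩ := hb.2 κ
    obtain ⟨μ₂, rfl⟩ := hb.2 κ'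
    have hv : μ₁.1 d = μ₂.1 d := by
      have := congrArg Subtype.val h
      simpa only [if_pos hd] using this
    have := hbijd.1 (Subtype.ext hv)
    rw [this]
  · intro x
    have hx' : (x : galoisCohomology ρ 1) ∈ (D'.atLevel 𝓕 d).selmerGroup := heq ▸ x.2
    obtain ⟨μ₁, hμ₁⟩ := hbijd.2 ⟨x, hx'⟩
    refine ⟨⟨fun n => if D.IsLevel n then μ₁.1 n else 0,
      isKolyvaginSystem_restrict hsub htr hfs ((KolyvaginDatum.mem_kolyvaginSystems_iff _ _ _).mp μ₁.2)⟩,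
      ?_⟩
    apply Subtype.ext
    change (if D.IsLevel d then μ₁.1 d else 0) = x
    rw [if_pos hd]
    exact congrArg Subtype.val hμ₁

end Summit.BirchSwinnertonDyer.BirchSwinnertonDyer.Theorems.KimAtThreeDeepLowerS24DeepRestriction

end
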